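import Summits.FinalStateConjecture.FinalStateConjecture.Theorems.ClusterCompletenessAdiabaticMultiKerrILEDFarSlab
import Summits.FinalStateConjecture.FinalStateConjecture.Theorems.ClusterCompletenessAdiabaticMultiKerrILEDFarDivergence
import Summits.FinalStateConjecture.FinalStateConjecture.Theorems.ClusterCompletenessAdiabaticMultiKerrILEDFarError
import Summits.FinalStateConjecture.FinalStateConjecture.Theorems.ClusterCompletenessAdiabaticMultiKerrILEDFarRegularity
import Summits.FinalStateConjecture.FinalStateConjecture.Theorems.ClusterCompletenessAdiabaticMultiKerrILEDZoneCutoff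
import Summits.FinalStateConjecture.FinalStateConjecture.Theorems.ClusterCompletenessRecedingDopplerBudgetZones
import Literature.Geometry.Lorentzian.KerrSchildSlabDivergence
import Literature.Geometry.Lorentzian.KerrSchildWaveCauchyProblem

/-!
# Crux `AdiabaticMultiKerrILED` (line `Sketch`) — the far-field Morawetz transport stub

`stub_farTransport` of the registered skeleton `Lines/Sketch.lean` of the crux
`stmt-FinalStateConjecture-14310`
(`Summit.FinalStateConjecture.FinalStateConjecture.Theses.ClusterCompleteness.AdiabaticMultiKerrILED`):
given zone kinematics (`stub_zoneKinematics`), the flat KSS multiplier pair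
(`stub_flatMorawetzBulk`) and the perforated Hardy inequality (`stub_perforatedHardy`) as
hypotheses, the lab-ball local energy of a normalised solution on `t > 0` is bounded by
`C (sup_{t ≥ 0} E[ψ](t) + ∑ᵢ ∫∫_{zoneᵢ ∩ ext} (∑(∂ψ)² + (ψ − c)²/Mᵢ²))`, with `d₀ = 1000`,
`α = v₀ = 1/10`. The proof instantiates the generic estimate `far_transport_estimate` with the
cut-off current of `far_divergence_eq` (zone cut-off `ζ` from `stub_zoneCutoff`, bounds
`abs_farCurrent_le` / `abs_farError_le`, zone geometry from `…FarGeometry.lean`) and splits the lab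
ball into the far ball and the zones.
-/

noncomputable section

set_option linter.dupNamespace false

open scoped ContDiff Topology ENNReal InnerProductSpace
open Filter Set MeasureTheory Literature.Geometry.Lorentzian Literature.Geometry.Lorentzian.KerrSchild
  Summit.FinalStateConjecture.FinalStateConjecture.Theorems

namespace Summit.FinalStateConjecture.FinalStateConjecture.Cruxes.AdiabaticMultiKerrILED.Sketch

/-! ### The far-field transport stub -/

/-- Lab-velocity bookkeeping: `t • (u⁰⁻¹ u⃗) = (t u⁰⁻¹) • u⃗`. [folklore] -/
theorem smul_inv_smul_spatial (u : E4) (t : ℝ) :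
    t • ((u 0)⁻¹ • E4.spatial u) = (t * (u 0)⁻¹) • E4.spatial u :=
  smul_smul _ _ _


open Literature.Geometry.Lorentzian.E4 in
/-- **Far-field Morawetz transport** (registered stub `stub_farTransport` of the line `Sketch`).
Given zone kinematics (ZG), a flat KSS multiplier pair (FMB) and the perforated Hardy inequality
(PH): with `d₀ = 1000`, `α = v₀ = 1/10`, for every configuration and every `R` there is `C` such
that for every smooth solution `ψ` normalised by `c` at `t = 0`,
`∫_{t>0}∫_{‖y‖ ≤ R, exterior} ∑(∂ψ)² ≤ C (sup_{t ≥ 0} E[ψ](t) + ∑ᵢ ∫_{t>0}∫_{zoneᵢ ∩ exterior} (∑(∂ψ)² + (ψ − c)²/Mᵢ²))`.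
Proof: cut the flat Morawetz pair off by the zone cut-off `ζ` of `stub_zoneCutoff`, run
`far_transport_estimate` with the current of `far_divergence_eq`, the bounds `abs_farCurrent_le` /
`abs_farError_le`, and split the lab ball into the far ball `{∀ i, 35Mᵢ ≤ ‖y − cᵢ(t)‖}` and the
zones (`‖y − cᵢ(t)‖ < 35Mᵢ ⇒ rᵢ < 64Mᵢ`). [step of the line] -/
theorem stub_farTransport :
    (∀ (Λ : lorentzGroup) (p : E3) (u : E4) (q : E4 → E4), u = (Λ : E4 ≃L[ℝ] E4) (basisVector 0) → (∀ x,
      q x = poincareInv Λ (ofTimeSpace 0 p) x) → 0 < u 0 → ∀ (t : ℝ) (y : E3), ‖y - p - (t * (u 0)⁻¹) •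
      spatial u‖ ^ 2 ≤ spatialNorm (q (ofTimeSpace t y)) ^ 2 ∧ spatialNorm (q (ofTimeSpace t y)) ^ 2 ≤
      (u 0) ^ 2 * ‖y - p - (t * (u 0)⁻¹) • spatial u‖ ^ 2) → (∀ R : ℝ, 0 < R → ∃ (g ϖ : ℝ → ℝ) (c₀ : ℝ),
      0 < c₀ ∧ ContDiff ℝ ∞ (fun y ↦ g (spatialNorm y ^ 2)) ∧ ContDiff ℝ ∞ (fun y ↦ ϖ (spatialNorm y ^
      2)) ∧ (∀ y, |g (spatialNorm y ^ 2)| * spatialNorm y ≤ 1) ∧ (∀ y, |ϖ (spatialNorm y ^ 2)| *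
      (spatialNorm y + R) ≤ 8) ∧ (∀ y, ‖fderiv ℝ (fun z ↦ ϖ (spatialNorm z ^ 2)) y‖ * (spatialNorm y +
      R) ^ 2 ≤ 32) ∧ (∀ (w : E4 → ℝ) (x : E4), 0 ≤ multiplierBulk (fun _ ↦ Kerr.etaComp) (fun y α ↦ if α
      = 0 then 0 else g (spatialNorm y ^ 2) * y α) w x + 4⁻¹ * (ϖ (spatialNorm x ^ 2) * ∑ α, ∑ β,
      Kerr.etaComp α β * fderiv ℝ w x (basisVector α) * fderiv ℝ w x (basisVector β)) - 8⁻¹ *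
      waveOperator (fun _ ↦ Kerr.etaComp) (fun y ↦ ϖ (spatialNorm y ^ 2)) x * w x ^ 2) ∧ (∀ (w : E4 → ℝ)
      (x : E4), spatialNorm x ≤ R → c₀ * ∑ μ, (fderiv ℝ w x (basisVector μ)) ^ 2 ≤ multiplierBulk (fun _
      ↦ Kerr.etaComp) (fun y α ↦ if α = 0 then 0 else g (spatialNorm y ^ 2) * y α) w x + 4⁻¹ * (ϖ
      (spatialNorm x ^ 2) * ∑ α, ∑ β, Kerr.etaComp α β * fderiv ℝ w x (basisVector α) * fderiv ℝ w x
      (basisVector β)) - 8⁻¹ * waveOperator (fun _ ↦ Kerr.etaComp) (fun y ↦ ϖ (spatialNorm y ^ 2)) x * w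
      x ^ 2)) → (∃ K : NNReal, ∀ (n : ℕ) (c : Fin n → E3) (ρ : Fin n → ℝ), (∀ i, 0 < ρ i) → (∀ i j, i ≠
      j → 4 * (ρ i + ρ j) ≤ dist (c i) (c j)) → ∀ φ : E3 → ℝ, (∀ y : E3, (∀ i, ρ i < dist y (c i)) →
      ContDiffAt ℝ 1 φ y) → (∃ ρ₀ : ℝ, ∫⁻ y in {y : E3 | ρ₀ < ‖y‖}, ENNReal.ofReal (φ y ^ 2 / ‖y‖ ^ 2) <
      ⊤) → ∀ y₀ : E3, ∫⁻ y in {y : E3 | ∀ i, 2 * ρ i < dist y (c i)}, ENNReal.ofReal (φ y ^ 2 / ‖y - y₀‖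
      ^ 2) ≤ (K : ENNReal) * ∫⁻ y in {y : E3 | ∀ i, ρ i < dist y (c i)}, ENNReal.ofReal (‖fderiv ℝ φ y‖
      ^ 2)) → ∀ N : ℕ, ∃ d₀ α v₀ : ℝ, 0 < d₀ ∧ 0 < α ∧ 0 < v₀ ∧ ∀ (M a : Fin N → ℝ) (Λ : Fin N →
      lorentzGroup) (p : Fin N → E3) (u : Fin N → E4) (q : Fin N → E4 → E4), (∀ i, u i = (Λ i : E4 ≃L[ℝ]
      E4) (basisVector 0)) → (∀ i x, q i x = poincareInv (Λ i) (ofTimeSpace 0 (p i)) x) → (∀ i, 0 < M i)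
      → (∀ i, |a i| ≤ α * M i) → (∀ i, 0 < u i 0 ∧ ‖spatial (u i)‖ ≤ v₀ * u i 0) → (∀ i j, i ≠ j → d₀ *
      (M i + M j) ≤ dist (p i) (p j) ∧ 0 < ⟪p i - p j, (u i 0)⁻¹ • spatial (u i) - (u j 0)⁻¹ • spatial
      (u j)⟫_ℝ) → ∀ (G : E4 → Fin 4 → Fin 4 → ℝ), (∀ x μ ν, G x μ ν = Minkowski.bilin (basisVector μ)
      (basisVector ν) - ∑ i, Real.smoothTransition (2 - Kerr.radius (a i) (q i x) / (8 * M i)) * (2 *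
      Kerr.scalarH (M i) (a i) (q i x)) * ((Λ i : E4 ≃L[ℝ] E4) (Kerr.nullVector (a i) (q i x))) μ * ((Λ
      i : E4 ≃L[ℝ] E4) (Kerr.nullVector (a i) (q i x))) ν) → ∀ (E : (E4 → ℝ) → ℝ → ENNReal), (∀ φ t, E φ
      t = ∫⁻ y in {y : E3 | ∀ i, Kerr.rPlus (M i) (a i) < Kerr.radius (a i) (q i (ofTimeSpace t y))},
      ENNReal.ofReal (∑ μ, (fderiv ℝ φ (ofTimeSpace t y) (basisVector μ)) ^ 2)) → ∀ R : ℝ, ∃ C : NNReal,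
      ∀ ψ : E4 → ℝ, ContDiff ℝ ∞ ψ → (∀ x : E4, 0 ≤ x 0 → (∀ i, Kerr.rPlus (M i) (a i) < Kerr.radius (a
      i) (q i x)) → ∑ μ, fderiv ℝ (fun y ↦ ∑ ν : Fin 4, G y μ ν * fderiv ℝ ψ y (basisVector ν)) x
      (basisVector μ) = 0) → ∀ c : ℝ, (∃ ρ : ℝ, ∫⁻ y in {y : E3 | ρ < ‖y‖}, ENNReal.ofReal ((ψ
      (ofTimeSpace 0 y) - c) ^ 2 / ‖y‖ ^ 2) < ⊤) → ∫⁻ t in Set.Ioi 0, ∫⁻ y in {y : E3 | ‖y‖ ≤ R ∧ ∀ i,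
      Kerr.rPlus (M i) (a i) < Kerr.radius (a i) (q i (ofTimeSpace t y))}, ENNReal.ofReal (∑ μ, (fderiv
      ℝ ψ (ofTimeSpace t y) (basisVector μ)) ^ 2) ≤ (C : ENNReal) * ((⨆ t : ℝ, ⨆ (_ : 0 ≤ t), E ψ t) + ∑
      i, ∫⁻ t in Set.Ioi 0, ∫⁻ y in {y : E3 | Kerr.radius (a i) (q i (ofTimeSpace t y)) < 64 * M i ∧ ∀
      j, Kerr.rPlus (M j) (a j) < Kerr.radius (a j) (q j (ofTimeSpace t y))}, (ENNReal.ofReal (∑ μ,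
      (fderiv ℝ ψ (ofTimeSpace t y) (basisVector μ)) ^ 2) + ENNReal.ofReal ((ψ (ofTimeSpace t y) - c) ^
      2 / (M i) ^ 2))) := by
  intro hZG hFMB hPH N
  obtain ⟨K, hPH⟩ := hPH
  refine ⟨1000, 1 / 10, 1 / 10, by norm_num, by norm_num, by norm_num, ?_⟩
  intro M a Λ p u q hu hq hM ha hv hsep G hG E hE R
  -- lab velocities and the moving centres
  set v : Fin N → E3 := fun i ↦ (u i 0)⁻¹ • E4.spatial (u i) with hv_def
  have hvdef : ∀ (i : Fin N) (t : ℝ), t • v i = (t * (u i 0)⁻¹) • E4.spatial (u i) := fun i t ↦ by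
    simp only [hv_def]; exact smul_inv_smul_spatial (u i) t
  have hv1 : ∀ i, ‖v i‖ ≤ 1 := fun i ↦ (norm_velocity_le (hv i)).trans (by norm_num)
  have hsep70 : ∀ t : ℝ, 0 ≤ t → ∀ i j, i ≠ j →
      70 * (M i + M j) ≤ ‖(p i + t • v i) - (p j + t • v j)‖ := by
    intro t ht i j hij
    have h1 := (hsep i j hij).1
    have h2 : dist (p i) (p j) ≤ ‖(p i + t • v i) - (p j + t • v j)‖ :=
      RecedingDoppler.dist_le_norm_centre_sub (hsep i j hij).2 ht
    have := hM i
    have := hM j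
    linarith
  -- the flat multiplier pair on `R' = max R 1` and the zone cut-off
  have hR'pos : 0 < max R 1 := lt_of_lt_of_le one_pos (le_max_right R 1)
  obtain ⟨g, ϖ, c₀, hc₀, hg, hϖ, hgb, hϖb, hdϖb, hB0, hBlow⟩ := hFMB (max R 1) hR'pos
  obtain ⟨ζ, hζ, hζ01, hζ0, hζ1, hζsupp, Kζ, hKζ⟩ := stub_zoneCutoff N M p v hM hsep70
  -- constants
  have hKζ0 : 0 ≤ Kζ :=
    (norm_nonneg _).trans (hKζ (E4.ofTimeSpace 0 0) (le_of_eq (E4.ofTimeSpace_apply_zero 0 0).symm)).1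
  have hM2 : 0 ≤ ∑ i, M i ^ 2 := Finset.sum_nonneg fun i _ ↦ sq_nonneg _
  set Cb : ℝ := 5 + 12 * K + Kζ / max R 1 * (1156 * K * ∑ i, M i ^ 2) with hCb
  set Ce : ℝ := 18 * Kζ + 36 * Kζ * (∑ i, M i ^ 2) + 1 with hCe
  have hCb0 : 0 ≤ Cb := by rw [hCb]; positivity
  have hCe0 : 0 ≤ Ce := by rw [hCe]; positivity
  set Cr : ℝ := 2 * Cb / c₀ + Ce / c₀ + 1 with hCr
  have hCrpos : 0 < Cr := by rw [hCr]; positivity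
  refine ⟨Real.toNNReal Cr, ?_⟩
  intro ψ hψ hsol c hnorm
  -- the exterior and the zones as subsets of the slab
  set Ext : Set (ℝ × E3) := {z : ℝ × E3 | ∀ i, Kerr.rPlus (M i) (a i) <
    Kerr.radius (a i) (q i (E4.ofTimeSpace z.1 z.2))} with hExt
  set Zone : Fin N → Set (ℝ × E3) := fun i ↦ {z : ℝ × E3 |
    Kerr.radius (a i) (q i (E4.ofTimeSpace z.1 z.2)) < 64 * M i ∧
      ∀ j, Kerr.rPlus (M j) (a j) < Kerr.radius (a j) (q j (E4.ofTimeSpace z.1 z.2))} with hZone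
  set FarSet : Set (ℝ × E3) := {z : ℝ × E3 | ‖z.2‖ ≤ max R 1 ∧
    ∀ i, 35 * M i ≤ ‖z.2 - p i - z.1 • v i‖} with hFarSet
  have hqc : ∀ i, Continuous (q i) := fun i ↦ by
    have : q i = poincareInv (Λ i) (E4.ofTimeSpace 0 (p i)) := funext (hq i)
    rw [this]
    exact continuous_poincareInv _ _
  have hrc : ∀ i, Continuous fun z : ℝ × E3 ↦ Kerr.radius (a i) (q i (E4.ofTimeSpace z.1 z.2)) :=
    fun i ↦ (Kerr.continuous_radius (a i)).comp ((hqc i).comp E4.continuous_ofTimeSpace_uncurry)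
  have hExtm : MeasurableSet Ext := by
    have : Ext = ⋂ i, {z : ℝ × E3 | Kerr.rPlus (M i) (a i) <
        Kerr.radius (a i) (q i (E4.ofTimeSpace z.1 z.2))} := by
      ext z; simp [hExt]
    rw [this]
    exact MeasurableSet.iInter fun i ↦ (isOpen_lt continuous_const (hrc i)).measurableSet
  have hZm : ∀ i, MeasurableSet (Zone i) := by
    intro i
    have : Zone i = {z : ℝ × E3 | Kerr.radius (a i) (q i (E4.ofTimeSpace z.1 z.2)) < 64 * M i} ∩ Ext := by
      ext z; simp [hZone, hExt]
    rw [this]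
    exact (isOpen_lt (hrc i) continuous_const).measurableSet.inter hExtm
  have hFarSetm : MeasurableSet FarSet := by
    have h1 : MeasurableSet {z : ℝ × E3 | ‖z.2‖ ≤ max R 1} :=
      (isClosed_le continuous_snd.norm continuous_const).measurableSet
    have h2 : ∀ i, MeasurableSet {z : ℝ × E3 | 35 * M i ≤ ‖z.2 - p i - z.1 • v i‖} := fun i ↦
      (isClosed_le continuous_const ((continuous_snd.sub continuous_const).sub
        (continuous_fst.smul continuous_const)).norm).measurableSet
    have : FarSet = {z : ℝ × E3 | ‖z.2‖ ≤ max R 1} ∩ ⋂ i, {z : ℝ × E3 | 35 * M i ≤ ‖z.2 - p i - z.1 • v i‖} := by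
      ext z; simp [hFarSet]
    rw [this]
    exact h1.inter (MeasurableSet.iInter h2)
  -- geometry of the zones
  have hext : ∀ t : ℝ, 0 ≤ t → ∀ y : E3, (∀ j, 3 * M j < ‖y - p j - t • v j‖) → (t, y) ∈ Ext := by
    intro t _ y hy
    simp only [hExt, Set.mem_setOf_eq]
    intro i
    exact rPlus_lt_radius_of_norm_d_gt hZG (hu i) (hq i) (hv i).1 (hM i) (ha i)
      (by rw [← hvdef]; exact hy i)
  have hshell : ∀ t : ℝ, 0 ≤ t → ∀ (y : E3) (i : Fin N), ‖y - p i - t • v i‖ ≤ 34 * M i →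
      (∀ j, 17 * M j ≤ ‖y - p j - t • v j‖) → (t, y) ∈ Zone i := by
    intro t _ y i hi h17
    simp only [hZone, Set.mem_setOf_eq]
    refine ⟨radius_lt_sixtyfour_of_norm_d_le hZG (hu i) (hq i) (hv i) (hM i)
      (by rw [← hvdef]; linarith [hi, hM i]), fun j ↦ ?_⟩
    exact rPlus_lt_radius_of_norm_d_gt hZG (hu j) (hq j) (hv j).1 (hM j) (ha j)
      (by rw [← hvdef]; linarith [h17 j, hM j])
  have hζfar : ∀ x : E4, ζ x ≠ 0 → ∀ i, 16 * M i < Kerr.radius (a i) (q i x) := by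
    intro x hx i
    have h17 := hζsupp x hx i
    have hx' : E4.ofTimeSpace (x 0) (E4.spatial x) = x := E4.ofTimeSpace_time_spatial x
    have := radius_gt_sixteen_of_norm_d_ge hZG (hu i) (hq i) (hv i).1 (hM i) (ha i)
      (t := x 0) (y := E4.spatial x) (by rw [← hvdef]; exact h17)
    rwa [hx'] at this
  -- the exterior energy and its supremum
  set S : ℝ≥0∞ := ⨆ t : ℝ, ⨆ (_ : 0 ≤ t), E ψ t with hS_def
  have hS : ∀ t : ℝ, 0 ≤ t → ∫⁻ y in {y : E3 | (t, y) ∈ Ext},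
      ENNReal.ofReal (∑ κ : Fin 4, (fderiv ℝ ψ (E4.ofTimeSpace t y) (E4.basisVector κ)) ^ 2) ≤ S := by
    intro t ht
    have hEt : E ψ t = ∫⁻ y in {y : E3 | (t, y) ∈ Ext},
        ENNReal.ofReal (∑ κ : Fin 4, (fderiv ℝ ψ (E4.ofTimeSpace t y) (E4.basisVector κ)) ^ 2) := by
      rw [hE]
      rfl
    rw [← hEt]
    exact le_iSup₂ (f := fun (t : ℝ) (_ : 0 ≤ t) ↦ E ψ t) t ht
  -- the trivial case `S = ∞`
  by_cases hStop : S = ⊤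
  · have hC0 : ((Real.toNNReal Cr : NNReal) : ℝ≥0∞) ≠ 0 := by
      rw [ENNReal.coe_ne_zero]
      exact fun h ↦ absurd (Real.toNNReal_eq_zero.mp h) (not_le.mpr hCrpos)
    calc _ ≤ (⊤ : ℝ≥0∞) := le_top
      _ = _ := by rw [hStop, top_add, ENNReal.mul_top hC0]
  -- the far-field objects
  set J : Fin 4 → E4 → ℝ := fun μ x ↦
    multiplierCurrent (fun _ ↦ Kerr.etaComp)
        (fun z α ↦ ζ z * (if α = 0 then (0 : ℝ) else g (E4.spatialNorm z ^ 2) * z α))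
        (fun z ↦ ψ z - c) x μ +
      4⁻¹ * lagrangianCurrent (fun _ ↦ Kerr.etaComp) (fun z ↦ ζ z * ϖ (E4.spatialNorm z ^ 2))
        (fun z ↦ ψ z - c) x μ with hJ_def
  set B : E4 → ℝ := fun x ↦
    multiplierBulk (fun _ ↦ Kerr.etaComp)
        (fun z α ↦ if α = 0 then (0 : ℝ) else g (E4.spatialNorm z ^ 2) * z α) (fun z ↦ ψ z - c) x +
      4⁻¹ * (ϖ (E4.spatialNorm x ^ 2) * ∑ α, ∑ β, Kerr.etaComp α β *
        fderiv ℝ (fun z ↦ ψ z - c) x (E4.basisVector α) *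
          fderiv ℝ (fun z ↦ ψ z - c) x (E4.basisVector β)) -
      8⁻¹ * waveOperator (fun _ ↦ Kerr.etaComp) (fun z ↦ ϖ (E4.spatialNorm z ^ 2)) x *
        (ψ x - c) ^ 2 with hB_def
  set Err : E4 → ℝ := fun x ↦
    (∑ μ, multiplierCurrent (fun _ ↦ Kerr.etaComp)
        (fun z α ↦ if α = 0 then (0 : ℝ) else g (E4.spatialNorm z ^ 2) * z α)
        (fun z ↦ ψ z - c) x μ * fderiv ℝ ζ x (E4.basisVector μ)) -
      8⁻¹ * (2 * (∑ μ, ∑ ν, Kerr.etaComp μ ν * fderiv ℝ ζ x (E4.basisVector μ) *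
        fderiv ℝ (fun z : E4 ↦ ϖ (E4.spatialNorm z ^ 2)) x (E4.basisVector ν)) +
        ϖ (E4.spatialNorm x ^ 2) * waveOperator (fun _ ↦ Kerr.etaComp) ζ x) * (ψ x - c) ^ 2
    with hErr_def
  -- regularity
  have hφ2 : ContDiff ℝ 2 (fun z ↦ ψ z - c) := (hψ.of_le (by norm_cast)).sub contDiff_const
  have hXg : ∀ α, ContDiff ℝ ∞
      (fun z : E4 ↦ if α = 0 then (0 : ℝ) else g (E4.spatialNorm z ^ 2) * z α) := by
    intro α
    by_cases hα : α = 0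
    · simp only [hα, if_true]
      exact contDiff_const
    · simp only [hα, if_false]
      exact hg.mul (Kerr.contDiff_coord α)
  have hX1 : ∀ α, ContDiff ℝ 1
      (fun z : E4 ↦ ζ z * (if α = 0 then (0 : ℝ) else g (E4.spatialNorm z ^ 2) * z α)) :=
    fun α ↦ (hζ.mul (hXg α)).of_le (by norm_cast)
  have hϖζ2 : ContDiff ℝ 2 (fun z : E4 ↦ ζ z * ϖ (E4.spatialNorm z ^ 2)) :=
    (hζ.mul hϖ).of_le (by norm_cast)
  have hG1 : ∀ μ ν : Fin 4, ContDiff ℝ 1 fun x : E4 ↦ (fun _ : E4 ↦ Kerr.etaComp) x μ ν :=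
    fun μ ν ↦ contDiff_const
  have hJ1 : ∀ μ, ContDiff ℝ 1 (J μ) := fun μ ↦ by
    simp only [hJ_def]
    exact (contDiff_multiplierCurrent hG1 hX1 hφ2 μ).add
      (contDiff_const.mul (contDiff_lagrangianCurrent hG1 hϖζ2 hφ2 μ))
  have hp : ∀ κ, Continuous fun x ↦ fderiv ℝ (fun z ↦ ψ z - c) x (E4.basisVector κ) := fun κ ↦
    (hφ2.continuous_fderiv two_ne_zero).clm_apply continuous_const
  have hϖc : Continuous fun x : E4 ↦ ϖ (E4.spatialNorm x ^ 2) := hϖ.continuous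
  have hφc : Continuous fun x ↦ ψ x - c := hφ2.continuous
  have hBc : Continuous B := by
    have h1 : Continuous (multiplierBulk (fun _ : E4 ↦ Kerr.etaComp)
        (fun z α ↦ if α = 0 then (0 : ℝ) else g (E4.spatialNorm z ^ 2) * z α) (fun z ↦ ψ z - c)) :=
      continuous_multiplierBulk_of_contDiff hG1 (fun α ↦ (hXg α).of_le (by norm_cast)) hφ2
    have hbox : Continuous (waveOperator (fun _ : E4 ↦ Kerr.etaComp)
        (fun z ↦ ϖ (E4.spatialNorm z ^ 2))) :=
      continuous_waveOperator_of_contDiff hG1 (hϖ.of_le (by norm_cast))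
    simp only [hB_def]
    exact (h1.add (continuous_const.mul (hϖc.mul (continuous_finsetSum _ fun α _ ↦
      continuous_finsetSum _ fun β _ ↦ (continuous_const.mul (hp α)).mul (hp β))))).sub
      ((continuous_const.mul hbox).mul (hφc.pow 2))
  have hErrc : Continuous Err := by
    have hmc : ∀ μ, Continuous fun x ↦ multiplierCurrent (fun _ : E4 ↦ Kerr.etaComp)
        (fun z α ↦ if α = 0 then (0 : ℝ) else g (E4.spatialNorm z ^ 2) * z α) (fun z ↦ ψ z - c) x μ :=
      fun μ ↦ (contDiff_multiplierCurrent hG1 (fun α ↦ (hXg α).of_le (by norm_cast)) hφ2 μ).continuous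
    have hdζ : ∀ μ, Continuous fun x ↦ fderiv ℝ ζ x (E4.basisVector μ) := fun μ ↦
      (hζ.continuous_fderiv (by simp)).clm_apply continuous_const
    have hdϖ : ∀ ν, Continuous fun x ↦
        fderiv ℝ (fun z : E4 ↦ ϖ (E4.spatialNorm z ^ 2)) x (E4.basisVector ν) := fun ν ↦
      (hϖ.continuous_fderiv (by simp)).clm_apply continuous_const
    have hboxζ : Continuous (waveOperator (fun _ : E4 ↦ Kerr.etaComp) ζ) :=
      continuous_waveOperator_of_contDiff hG1 (hζ.of_le (by norm_cast))
    simp only [hErr_def]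
    exact (continuous_finsetSum _ fun μ _ ↦ (hmc μ).mul (hdζ μ)).sub
      ((continuous_const.mul ((continuous_const.mul (continuous_finsetSum _ fun μ _ ↦
        continuous_finsetSum _ fun ν _ ↦ (continuous_const.mul (hdζ μ)).mul (hdϖ ν))).add
        (hϖc.mul hboxζ))).mul (hφc.pow 2))
  -- the structural facts
  have hB0' : ∀ x, 0 ≤ B x := fun x ↦ hB0 (fun z ↦ ψ z - c) x
  have hBlow' : ∀ x : E4, E4.spatialNorm x ≤ max R 1 →
      c₀ * ∑ κ : Fin 4, (fderiv ℝ ψ x (E4.basisVector κ)) ^ 2 ≤ B x := by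
    intro x hx
    rw [← fderiv_sub_const (f := ψ) (x := x) c]
    exact hBlow (fun z ↦ ψ z - c) x hx
  have hdiv : ∀ x : E4, 0 ≤ x 0 → ∑ μ, fderiv ℝ (J μ) x (E4.basisVector μ) = ζ x * B x + Err x := by
    intro x hx0
    simp only [hJ_def, hB_def, hErr_def]
    exact far_divergence_eq hq hM hG hψ hsol c hg hϖ hζ hζfar hx0
  have hJb' : ∀ (x : E4) (μ : Fin 4), 0 ≤ x 0 →
      |J μ x| ≤ 5 * ζ x * (∑ κ, (fderiv ℝ ψ x (E4.basisVector κ)) ^ 2) +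
        12 * ζ x * ((ψ x - c) ^ 2 / (E4.spatialNorm x + max R 1) ^ 2) +
        |fderiv ℝ ζ x (E4.basisVector μ)| * ((ψ x - c) ^ 2 / (E4.spatialNorm x + max R 1)) := by
    intro x μ _
    have h := abs_farCurrent_le hR'pos hgb hϖb hdϖb hζ01 ((hζ.differentiable (by simp)) x)
      ((hϖ.differentiable (by simp)) x) (fun z ↦ ψ z - c) μ
    rw [fderiv_sub_const] at h
    exact h
  have hErrb' : ∀ x : E4, 0 ≤ x 0 →
      |Err x| ≤ 18 * ‖fderiv ℝ ζ x‖ * (∑ κ, (fderiv ℝ ψ x (E4.basisVector κ)) ^ 2) +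
        (32 * ‖fderiv ℝ ζ x‖ / (E4.spatialNorm x + max R 1) ^ 2 +
          4 * ‖fderiv ℝ (fderiv ℝ ζ) x‖ / (E4.spatialNorm x + max R 1)) * (ψ x - c) ^ 2 := by
    intro x _
    have h := abs_farError_le hR'pos hgb hϖb hdϖb ((hζ.of_le (by norm_cast)).contDiffAt)
      (fun z ↦ ψ z - c) (x := x)
    rw [fderiv_sub_const] at h
    exact h
  -- the generic transport estimate
  have hfar := far_transport_estimate hPH hM hv1 hsep70 hExtm hext (hψ.of_le (by norm_cast)) c hnorm hS
    hStop hζ.continuous hζ01 hζ0 hζ1 hζsupp hKζ hJ1 hBc hB0' hErrc (le_max_right R 1) hc₀ hBlow'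
    hdiv hJb' hErrb' hZm hshell
  -- the split of the lab ball
  have hsplit : ∀ t : ℝ, {y : E3 | ‖y‖ ≤ R ∧ ∀ i, Kerr.rPlus (M i) (a i) <
      Kerr.radius (a i) (q i (E4.ofTimeSpace t y))} ⊆
      {y : E3 | (t, y) ∈ FarSet} ∪ ⋃ i, {y : E3 | (t, y) ∈ Zone i} := by
    intro t y hy
    by_cases hfar35 : ∀ i, 35 * M i ≤ ‖y - p i - t • v i‖
    · exact Or.inl ⟨hy.1.trans (le_max_left R 1), hfar35⟩
    · push Not at hfar35
      obtain ⟨i, hi⟩ := hfar35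
      refine Or.inr (Set.mem_iUnion.mpr ⟨i, ?_⟩)
      simp only [hZone, Set.mem_setOf_eq]
      exact ⟨radius_lt_sixtyfour_of_norm_d_le hZG (hu i) (hq i) (hv i) (hM i)
        (by rw [← hvdef]; exact hi.le), hy.2⟩
  have hPm : Measurable fun z : ℝ × E3 ↦
      ENNReal.ofReal (∑ κ : Fin 4, (fderiv ℝ ψ (E4.ofTimeSpace z.1 z.2) (E4.basisVector κ)) ^ 2) :=
    ENNReal.measurable_ofReal.comp (continuous_energyDensity_uncurry (hψ.of_le (by norm_cast))).measurable
  have hFm := measurable_lintegral_slice hFarSetm hPm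
  have hGm := fun i ↦ measurable_lintegral_slice (hZm i) hPm
  have hinner : ∀ t : ℝ,
      ∫⁻ y in {y : E3 | ‖y‖ ≤ R ∧ ∀ i, Kerr.rPlus (M i) (a i) < Kerr.radius (a i) (q i (E4.ofTimeSpace t y))},
          ENNReal.ofReal (∑ μ : Fin 4, (fderiv ℝ ψ (E4.ofTimeSpace t y) (E4.basisVector μ)) ^ 2) ≤
        (∫⁻ y in {y : E3 | (t, y) ∈ FarSet},
          ENNReal.ofReal (∑ μ : Fin 4, (fderiv ℝ ψ (E4.ofTimeSpace t y) (E4.basisVector μ)) ^ 2)) +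
        ∑ i, ∫⁻ y in {y : E3 | (t, y) ∈ Zone i},
          ENNReal.ofReal (∑ μ : Fin 4, (fderiv ℝ ψ (E4.ofTimeSpace t y) (E4.basisVector μ)) ^ 2) := by
    intro t
    refine (lintegral_mono_set (hsplit t)).trans ((lintegral_union_le _ _ _).trans ?_)
    refine add_le_add le_rfl ?_
    exact (lintegral_iUnion_le _ _).trans_eq (tsum_fintype _)
  have hbook := far_constant_bookkeeping hc₀ hCb0 hCe0 hfar
  calc ∫⁻ t in Set.Ioi (0 : ℝ), ∫⁻ y in {y : E3 | ‖y‖ ≤ R ∧ ∀ i, Kerr.rPlus (M i) (a i) <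
            Kerr.radius (a i) (q i (E4.ofTimeSpace t y))},
            ENNReal.ofReal (∑ μ : Fin 4, (fderiv ℝ ψ (E4.ofTimeSpace t y) (E4.basisVector μ)) ^ 2)
      ≤ ∫⁻ t in Set.Ioi (0 : ℝ), ((∫⁻ y in {y : E3 | (t, y) ∈ FarSet},
          ENNReal.ofReal (∑ μ : Fin 4, (fderiv ℝ ψ (E4.ofTimeSpace t y) (E4.basisVector μ)) ^ 2)) +
        ∑ i, ∫⁻ y in {y : E3 | (t, y) ∈ Zone i},
          ENNReal.ofReal (∑ μ : Fin 4, (fderiv ℝ ψ (E4.ofTimeSpace t y) (E4.basisVector μ)) ^ 2)) :=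
        lintegral_mono fun t ↦ hinner t
    _ = (∫⁻ t in Set.Ioi (0 : ℝ), ∫⁻ y in {y : E3 | (t, y) ∈ FarSet},
          ENNReal.ofReal (∑ μ : Fin 4, (fderiv ℝ ψ (E4.ofTimeSpace t y) (E4.basisVector μ)) ^ 2)) +
        ∑ i, ∫⁻ t in Set.Ioi (0 : ℝ), ∫⁻ y in {y : E3 | (t, y) ∈ Zone i},
          ENNReal.ofReal (∑ μ : Fin 4, (fderiv ℝ ψ (E4.ofTimeSpace t y) (E4.basisVector μ)) ^ 2) := by
        rw [lintegral_add_left hFm, lintegral_finsetSum _ fun i _ ↦ hGm i]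
    _ ≤ (∫⁻ t in Set.Ioi (0 : ℝ), ∫⁻ y in {y : E3 | (t, y) ∈ FarSet},
          ENNReal.ofReal (∑ μ : Fin 4, (fderiv ℝ ψ (E4.ofTimeSpace t y) (E4.basisVector μ)) ^ 2)) +
        ∑ i, ∫⁻ t in Set.Ioi (0 : ℝ), ∫⁻ y in {y : E3 | (t, y) ∈ Zone i},
          (ENNReal.ofReal (∑ μ : Fin 4, (fderiv ℝ ψ (E4.ofTimeSpace t y) (E4.basisVector μ)) ^ 2) +
            ENNReal.ofReal ((ψ (E4.ofTimeSpace t y) - c) ^ 2 / M i ^ 2)) :=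
        add_le_add le_rfl (Finset.sum_le_sum fun i _ ↦
          lintegral_mono fun t ↦ lintegral_mono fun y ↦ le_self_add)
    _ ≤ ENNReal.ofReal Cr * (S + ∑ i, ∫⁻ t in Set.Ioi (0 : ℝ), ∫⁻ y in {y : E3 | (t, y) ∈ Zone i},
          (ENNReal.ofReal (∑ μ : Fin 4, (fderiv ℝ ψ (E4.ofTimeSpace t y) (E4.basisVector μ)) ^ 2) +
            ENNReal.ofReal ((ψ (E4.ofTimeSpace t y) - c) ^ 2 / M i ^ 2))) := hbook
    _ = _ := rfl

end Summit.FinalStateConjecture.FinalStateConjecture.Cruxes.AdiabaticMultiKerrILED.Sketch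

end
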